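import Summits.Parity.GeneralizedHardyLittlewood.Theses.ClassVarianceLadder
import Literature.NumberTheory.Sieve.HardyLittlewoodChowla
import Literature.NumberTheory.Sieve.MoebiusShiftedPrimesProofs

/-!
# Placement of the crux `MobiusCofactorAtom` (strategist r1, stmt-Parity-13833)

Sorry-free PLACEMENT THEOREMS for the rank-2 crux
`Summit.Parity.GeneralizedHardyLittlewood.Theses.ClassVarianceLadder.MobiusCofactorAtom`
of route `ClassVarianceLadder`.

The crux quantifies over EVERY nondegenerate unary system `Ψ : Fin (t+1) → AffLinForm 1` of
bounded size and bounds, for every `A > 0`, the positively weighted dilation sum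
`∑_{m ≤ N^δ} log m · |S_m(Ψ)|` by `N/(log N)^A`.  Positivity of the summands makes the single
term `m = 3` inherit the bound, and the nondegenerate system

  `Ψ = (n + a₀, …, n + a_{t-1} ; 3n + 3h₀)`   (`aᵢ` distinct, `h₀ ∉ {aᵢ}`)

turns `S_3(Ψ)` on `[1, X]` into the fixed-shift hybrid Hardy–Littlewood–Chowla sum
`∑_{n ≤ X} μ(n + h₀) ∏ᵢ Λ(n + aᵢ)` (the cofactor of the last form is `(3n+3h₀)/3 = n + h₀`).
Hence (all theorems below are kernel-checked, no `sorry`):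

* `fin_logSaving` / `hlc_logSaving_of_atom` — `MobiusCofactorAtom` implies, for every finite
  nonempty shift set `A`, every `h₀ ∉ A` and EVERY `C > 0`,
  `|hlcMoebiusSum A {h₀} X| ≤ X/(log X)^C` for `X ≥ X₀(A,h₀,C)`: the quantitative, FIXED-SHIFT
  form of the Hardy–Littlewood–Chowla conjecture with one Möbius factor
  (Lichtman–Teräväinen 2022, Conj. 1.1 with `k = 1`, every `ℓ`), of which print knows only
  shift-averaged / almost-all versions (`Literature.NumberTheory.Sieve.lichtmanTeravainen2022_hlc_avg`).
* `moebiusShiftedPrimesConjecture_of_atom` —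
  `MobiusCofactorAtom → Literature.NumberTheory.Sieve.MoebiusShiftedPrimesConjecture`
  (the registered OPEN conjecture `∑_{p ≤ X} μ(p+h) = o(π(X))` for every fixed `h ≥ 1`,
  `[status: open]`, Lichtman 2020 p.1 / Murty–Vatwani 2017 / Sarnak's list Problem 5.2).
  The passage from `Λ`-weights to primes is done WITHOUT Abel summation: write
  `μ(p+h) = (log p/log X)·μ(p+h) + (1 - log p/log X)·μ(p+h)`; the second part is at most
  `π(X) - θ(X)/log X = O(X/log²X)` (Mathlib `Chebyshev.primeCounting_sub_theta_div_log_isBigO`),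
  prime powers cost `ψ(X) - θ(X) ≤ 2√X log X` (Mathlib `Chebyshev.psi_sub_theta_le`), and
  `π(X) ≥ X/(2 log X)` eventually (tree: `Lichtman2020.eventually_primeCounting_ge`).

Consequence for the route (see `STRATEGY-CENSUS-r1.md`): the crux, already at `t = 1`, `m = 3`,
contains the fixed-shift Möbius–shifted-primes problem with an arbitrary log-power saving; it is
therefore placed ABOVE a named open problem of the literature, independently of the summit
`GeneralizedHardyLittlewood` (which, being a statement about finite-complexity systems of linear
forms in the primes, neither implies nor is implied by it as far as the tree knows).
-/

open Finset Filter Asymptotics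
open scoped ArithmeticFunction.vonMangoldt ArithmeticFunction.Moebius

namespace Summit.Parity.GeneralizedHardyLittlewood.Cruxes.MobiusCofactorAtom.PlacementR1

open Literature.NumberTheory.Sieve
open Summit.Parity.GeneralizedHardyLittlewood.Theses.ClassVarianceLadder (MobiusCofactorAtom)

/-! ## The forced system `(n + a₀, …, n + a_{t-1} ; 3n + 3h₀)` -/

/-- The unary affine-linear form `n ↦ c·n + b`. -/
def form (c b : ℤ) : AffLinForm 1 := ⟨fun _ => c, b⟩

@[simp] theorem form_coeff (c b : ℤ) (j : Fin 1) : (form c b).coeff j = c := rfl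

@[simp] theorem form_const (c b : ℤ) : (form c b).const = b := rfl

theorem form_eval_const (c b k : ℤ) : (form c b).eval (fun _ => k) = c * k + b := by
  simp [AffLinForm.eval, form]

/-- The forced system: `t` translates `n + aᵢ` followed by the last form `3n + 3h₀`. -/
def sys (t : ℕ) (a : Fin t → ℕ) (h₀ : ℕ) : Fin (t + 1) → AffLinForm 1 :=
  Fin.snoc (α := fun _ => AffLinForm 1) (fun i => form 1 (a i)) (form 3 (3 * (h₀ : ℤ)))

@[simp] theorem sys_last (t : ℕ) (a : Fin t → ℕ) (h₀ : ℕ) :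
    sys t a h₀ (Fin.last t) = form 3 (3 * (h₀ : ℤ)) := by
  simp [sys]

@[simp] theorem sys_castSucc (t : ℕ) (a : Fin t → ℕ) (h₀ : ℕ) (i : Fin t) :
    sys t a h₀ i.castSucc = form 1 (a i) := by
  simp [sys]

/-- The forced system is nondegenerate in the Green–Tao sense as soon as the shifts `aᵢ` are
distinct and differ from `h₀`. -/
theorem sys_nondegenerate (t : ℕ) (a : Fin t → ℕ) (h₀ : ℕ) (ha : Function.Injective a)
    (hh : ∀ i, a i ≠ h₀) : IsNondegenerateSystem (sys t a h₀) := by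
  refine ⟨?_, ?_⟩
  · intro i hc
    obtain ⟨i, rfl⟩ | rfl := i.eq_castSucc_or_eq_last
    · have := congrFun hc 0
      simp at this
    · have := congrFun hc 0
      simp at this
  · intro i j hij c d hcd
    have h0 := hcd fun _ => 0
    have h1 := hcd fun _ => 1
    obtain ⟨i, rfl⟩ | rfl := i.eq_castSucc_or_eq_last <;>
      obtain ⟨j, rfl⟩ | rfl := j.eq_castSucc_or_eq_last
    · -- two translates
      rw [sys_castSucc, sys_castSucc, form_eval_const, form_eval_const] at h0 h1
      have hcd' : c = d := by linear_combination h1 - h0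
      have hz : c * ((a i : ℤ) - a j) = 0 := by linear_combination h0 - (a j : ℤ) * hcd'
      rcases mul_eq_zero.1 hz with hc | hc
      · exact ⟨hc, by linarith⟩
      · exfalso
        have hij' : a i = a j := by exact_mod_cast (sub_eq_zero.1 hc)
        exact hij (by rw [ha hij'])
    · -- translate vs last form
      rw [sys_castSucc, sys_last, form_eval_const, form_eval_const] at h0 h1
      have hcd' : c = 3 * d := by linear_combination h1 - h0
      have hz : 3 * d * ((a i : ℤ) - h₀) = 0 := by linear_combination h0 - (a i : ℤ) * hcd'
      rcases mul_eq_zero.1 hz with hd | hd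
      · refine ⟨by linarith, by linarith⟩
      · exfalso
        have : a i = h₀ := by exact_mod_cast (sub_eq_zero.1 hd)
        exact hh i this
    · -- last form vs translate
      rw [sys_castSucc, sys_last, form_eval_const, form_eval_const] at h0 h1
      have hcd' : 3 * c = d := by linear_combination h1 - h0
      have hz : 3 * c * ((h₀ : ℤ) - a j) = 0 := by linear_combination h0 - (a j : ℤ) * hcd'
      rcases mul_eq_zero.1 hz with hc | hc
      · refine ⟨by linarith, by linarith⟩
      · exfalso
        have : a j = h₀ := by exact_mod_cast (sub_eq_zero.1 hc).symm
        exact hh j this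
    · exact absurd rfl hij

/-- A size parameter `L` dominating `‖sys‖_N` for every `N ≥ 1`. -/
def sizeBound (t : ℕ) (a : Fin t → ℕ) (h₀ : ℕ) : ℕ := (t + 1) * (3 + 3 * h₀ + ∑ i, a i)

theorem affLinSize_sys_le (t : ℕ) (a : Fin t → ℕ) (h₀ : ℕ) {N : ℕ} (hN : 1 ≤ N) :
    affLinSize (sys t a h₀) (N : ℝ) ≤ ((sizeBound t a h₀ : ℕ) : ℝ) := by
  have hN' : (1 : ℝ) ≤ N := by exact_mod_cast hN
  have hsum : 0 ≤ ∑ j, (a j : ℝ) := Finset.sum_nonneg fun j _ => Nat.cast_nonneg _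
  have hh₀ : (0 : ℝ) ≤ h₀ := Nat.cast_nonneg _
  have hB : ∀ i : Fin (t + 1),
      ∑ j, |(((sys t a h₀ i).coeff j : ℤ) : ℝ)| + |(((sys t a h₀ i).const : ℤ) : ℝ) / N| ≤
        3 + 3 * (h₀ : ℝ) + ∑ j, (a j : ℝ) := by
    intro i
    obtain ⟨i, rfl⟩ | rfl := i.eq_castSucc_or_eq_last
    · rw [sys_castSucc]
      simp only [form_coeff, form_const, Fin.sum_univ_one]
      push_cast
      have h1 : |(a i : ℝ) / N| ≤ a i := by
        rw [abs_of_nonneg (by positivity)]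
        exact div_le_self (Nat.cast_nonneg _) hN'
      have h2 : (a i : ℝ) ≤ ∑ j, (a j : ℝ) :=
        Finset.single_le_sum (f := fun j => (a j : ℝ)) (fun j _ => Nat.cast_nonneg _)
          (Finset.mem_univ i)
      rw [abs_one]
      linarith
    · rw [sys_last]
      simp only [form_coeff, form_const, Fin.sum_univ_one]
      push_cast
      have h1 : |(3 * (h₀ : ℝ)) / N| ≤ 3 * h₀ := by
        rw [abs_of_nonneg (by positivity)]
        exact div_le_self (by positivity) hN'
      rw [abs_of_pos (by norm_num : (0 : ℝ) < 3)]
      linarith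
  calc affLinSize (sys t a h₀) (N : ℝ)
      = ∑ i, (∑ j, |(((sys t a h₀ i).coeff j : ℤ) : ℝ)| + |(((sys t a h₀ i).const : ℤ) : ℝ) / N|) := by
        rw [affLinSize, Finset.sum_add_distrib]
    _ ≤ ∑ _i : Fin (t + 1), (3 + 3 * (h₀ : ℝ) + ∑ j, (a j : ℝ)) :=
        Finset.sum_le_sum fun i _ => hB i
    _ = ((sizeBound t a h₀ : ℕ) : ℝ) := by
        rw [Finset.sum_const, Finset.card_univ, Fintype.card_fin, nsmul_eq_mul]
        push_cast [sizeBound]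
        ring

/-! ## The `m = 3` term of the crux for the forced system -/

/-- For the forced system, the inner sum of the crux at dilation `m = 3` over `[1, X]` is the
fixed-shift hybrid sum `∑_{n ≤ X} μ(n + h₀) ∏ᵢ Λ(n + aᵢ)`. -/
theorem innerSum_three (t : ℕ) (a : Fin t → ℕ) (h₀ X : ℕ) :
    ∑ n ∈ (Finset.Icc (1 : ℤ) (X : ℤ)).filter (fun n : ℤ =>
        1 ≤ (sys t a h₀ (Fin.last t)).eval (fun _ => n) ∧
          ((3 : ℕ) : ℤ) ∣ (sys t a h₀ (Fin.last t)).eval (fun _ => n)),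
      (ArithmeticFunction.moebius (((sys t a h₀ (Fin.last t)).eval (fun _ => n)).toNat / 3) : ℝ) *
        ∏ i : Fin t, intVonMangoldt ((sys t a h₀ (Fin.castSucc i)).eval fun _ => n)
    = ∑ n ∈ Finset.Icc 1 X,
        (ArithmeticFunction.moebius (n + h₀) : ℝ) * ∏ i : Fin t, Λ (n + a i) := by
  have hall : ∀ n ∈ Finset.Icc (1 : ℤ) (X : ℤ),
      1 ≤ (sys t a h₀ (Fin.last t)).eval (fun _ => n) ∧
        ((3 : ℕ) : ℤ) ∣ (sys t a h₀ (Fin.last t)).eval (fun _ => n) := by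
    intro n hn
    rw [Finset.mem_Icc] at hn
    rw [sys_last, form_eval_const]
    exact ⟨by omega, ⟨n + h₀, by push_cast; ring⟩⟩
  rw [Finset.filter_true_of_mem hall]
  refine Finset.sum_nbij' (fun n : ℤ => n.toNat) (fun k : ℕ => (k : ℤ)) ?_ ?_ ?_ ?_ ?_
  · intro n hn
    simp only [Finset.mem_Icc] at hn ⊢
    omega
  · intro k hk
    simp only [Finset.mem_Icc] at hk ⊢
    omega
  · intro n hn
    simp only [Finset.mem_Icc] at hn
    omega
  · intro k _
    simp
  · intro n hn
    rw [Finset.mem_Icc] at hn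
    obtain ⟨k, rfl⟩ : ∃ k : ℕ, n = (k : ℤ) := ⟨n.toNat, (Int.toNat_of_nonneg (by omega)).symm⟩
    have e1 : (((sys t a h₀ (Fin.last t)).eval fun _ => (k : ℤ)).toNat / 3 : ℕ) = k + h₀ := by
      rw [sys_last, form_eval_const]
      have : (3 * (k : ℤ) + 3 * (h₀ : ℤ)) = ((3 * (k + h₀) : ℕ) : ℤ) := by push_cast; ring
      rw [this, Int.toNat_natCast, Nat.mul_div_cancel_left _ (by norm_num : 0 < 3)]
    have e2 : ∀ i : Fin t,
        intVonMangoldt ((sys t a h₀ i.castSucc).eval fun _ => (k : ℤ)) = Λ (k + a i) := by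
      intro i
      rw [sys_castSucc, form_eval_const, intVonMangoldt]
      have : (1 * (k : ℤ) + (a i : ℤ)) = ((k + a i : ℕ) : ℤ) := by push_cast; ring
      rw [this, Int.toNat_natCast]
    simp only [e1, e2, Int.toNat_natCast]

/-- Extracting one term from a bound on a sum of nonnegative terms. -/
theorem term_le_of_sum_le {s : Finset ℕ} {f : ℕ → ℝ} {B : ℝ} (h : ∑ m ∈ s, f m ≤ B)
    (hf : ∀ m ∈ s, 0 ≤ f m) {m₀ : ℕ} (hm₀ : m₀ ∈ s) : f m₀ ≤ B :=
  (Finset.single_le_sum hf hm₀).trans h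

/-- `1 ≤ log 3`. -/
theorem one_le_log_three : (1 : ℝ) ≤ Real.log 3 := by
  rw [Real.le_log_iff_exp_le (by norm_num)]
  exact Real.exp_one_lt_three.le

/-! ## Placement 1: fixed-shift Hardy–Littlewood–Chowla (one Möbius factor) with log-power saving -/

/-- **Placement, `Fin`-indexed form.** `MobiusCofactorAtom` implies: for distinct shifts
`a₀, …, a_{t-1}` (`t ≥ 1`), every `h₀ ∉ {aᵢ}` and every `C > 0`,
`|∑_{n ≤ X} μ(n + h₀) ∏ᵢ Λ(n + aᵢ)| ≤ X/(log X)^C` for all large `X`. -/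
theorem fin_logSaving (hAt : MobiusCofactorAtom) {t : ℕ} (ht : 1 ≤ t) (a : Fin t → ℕ)
    (ha : Function.Injective a) (h₀ : ℕ) (hh : ∀ i, a i ≠ h₀) {C : ℝ} (hC : 0 < C) :
    ∃ X₀ : ℕ, ∀ X : ℕ, X₀ ≤ X →
      |∑ n ∈ Finset.Icc 1 X, (ArithmeticFunction.moebius (n + h₀) : ℝ) * ∏ i : Fin t, Λ (n + a i)|
        ≤ (X : ℝ) / Real.log X ^ C := by
  obtain ⟨δ, hδ, N₀, hN⟩ := hAt t ht (sizeBound t a h₀) C hC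
  refine ⟨N₀ + ⌈(3 : ℝ) ^ (1 / δ)⌉₊ + 1, fun X hX => ?_⟩
  have hXN : N₀ ≤ X := by omega
  have hX1 : 1 ≤ X := by omega
  have hceil : ⌈(3 : ℝ) ^ (1 / δ)⌉₊ ≤ X := by omega
  have key := hN X hXN (sys t a h₀) (sys_nondegenerate t a h₀ ha hh)
    (affLinSize_sys_le t a h₀ hX1) 1 X (by omega) le_rfl
  have h3mem : (3 : ℕ) ∈ Finset.Icc 1 ⌊(X : ℝ) ^ δ⌋₊ := by
    rw [Finset.mem_Icc]
    refine ⟨by norm_num, Nat.le_floor ?_⟩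
    have hx : (3 : ℝ) ^ (1 / δ) ≤ X := (Nat.le_ceil _).trans (by exact_mod_cast hceil)
    calc ((3 : ℕ) : ℝ) = ((3 : ℝ) ^ (1 / δ)) ^ δ := by
          rw [← Real.rpow_mul (by norm_num : (0 : ℝ) ≤ 3), one_div_mul_cancel hδ.ne',
            Real.rpow_one]
          norm_num
      _ ≤ (X : ℝ) ^ δ := Real.rpow_le_rpow (by positivity) hx hδ.le
  have h3 := term_le_of_sum_le key
    (fun m _ => mul_nonneg (Real.log_natCast_nonneg m) (abs_nonneg _)) h3mem
  beta_reduce at h3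
  rw [innerSum_three] at h3
  have hlog3 : (1 : ℝ) ≤ Real.log ((3 : ℕ) : ℝ) := by
    rw [Nat.cast_ofNat]
    exact one_le_log_three
  exact (le_mul_of_one_le_left (abs_nonneg _) hlog3).trans h3

/-- **Placement, `hlcMoebiusSum` form** (Lichtman–Teräväinen Conj. 1.1 with `k = 1`, FIXED shifts,
quantitative): `MobiusCofactorAtom` implies, for every nonempty finite `A ⊂ ℕ`, every `h₀ ∉ A`
and every `C > 0`, `|hlcMoebiusSum A {h₀} X| ≤ X/(log X)^C` for all large `X`. -/
theorem hlc_logSaving_of_atom (hAt : MobiusCofactorAtom) (A : Finset ℕ) (hA : A.Nonempty)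
    (h₀ : ℕ) (hh₀ : h₀ ∉ A) {C : ℝ} (hC : 0 < C) :
    ∃ X₀ : ℕ, ∀ X : ℕ, X₀ ≤ X → |hlcMoebiusSum A {h₀} X| ≤ (X : ℝ) / Real.log X ^ C := by
  set a : Fin A.card → ℕ := fun i => A.orderEmbOfFin rfl i with ha_def
  have ha : Function.Injective a := (A.orderEmbOfFin rfl).injective
  have hmem : ∀ i, a i ∈ A := fun i => Finset.orderEmbOfFin_mem A rfl i
  have hh : ∀ i, a i ≠ h₀ := fun i h => hh₀ (h ▸ hmem i)
  have ht : 1 ≤ A.card := Finset.card_pos.2 hA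
  obtain ⟨X₀, hX₀⟩ := fin_logSaving hAt ht a ha h₀ hh hC
  refine ⟨X₀, fun X hX => ?_⟩
  have hprod : ∀ n : ℕ, ∏ i : Fin A.card, Λ (n + a i) = ∏ x ∈ A, Λ (n + x) := by
    intro n
    rw [← Finset.prod_image (s := Finset.univ) (g := a) (f := fun x => Λ (n + x))
      (fun x _ y _ hxy => ha hxy)]
    rw [ha_def, Finset.image_orderEmbOfFin_univ]
  have hsum : hlcMoebiusSum A {h₀} X =
      ∑ n ∈ Finset.Icc 1 X, (ArithmeticFunction.moebius (n + h₀) : ℝ) * ∏ i : Fin A.card, Λ (n + a i) := by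
    rw [hlcMoebiusSum]
    refine Finset.sum_congr rfl fun n _ => ?_
    rw [hprod n, Finset.prod_singleton, mul_comm]
  rw [hsum]
  exact hX₀ X hX

/-- The case `A = {0}`: `MobiusCofactorAtom` gives `|∑_{n ≤ X} Λ(n) μ(n + h)| ≤ X/(log X)^C` for
every fixed `h ≥ 1`, every `C > 0` and all large `X`. -/
theorem vonMangoldt_moebius_logSaving_of_atom (hAt : MobiusCofactorAtom) (h : ℕ) (hh : 1 ≤ h)
    {C : ℝ} (hC : 0 < C) :
    ∃ X₀ : ℕ, ∀ X : ℕ, X₀ ≤ X →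
      |∑ n ∈ Finset.Icc 1 X, Λ n * (ArithmeticFunction.moebius (n + h) : ℝ)|
        ≤ (X : ℝ) / Real.log X ^ C := by
  obtain ⟨X₀, hX₀⟩ := hlc_logSaving_of_atom hAt {0} (Finset.singleton_nonempty 0) h
    (by simp; omega) hC
  refine ⟨X₀, fun X hX => ?_⟩
  rw [← hlcMoebiusSum_zero_singleton]
  exact hX₀ X hX

/-! ## Placement 2: the Möbius–shifted-primes conjecture -/

/-- `T_h(X) = ∑_{p ≤ X} log p · μ(p + h)`. -/
noncomputable def logWeighted (h X : ℕ) : ℝ :=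
  ∑ p ∈ Nat.primesLE X, Real.log p * (ArithmeticFunction.moebius (p + h) : ℝ)

/-- `R_h(X) = ∑_{p ≤ X} (1 - log p / log X) · μ(p + h)`. -/
noncomputable def remainderR (h X : ℕ) : ℝ :=
  ∑ p ∈ Nat.primesLE X, (1 - Real.log p / Real.log X) * (ArithmeticFunction.moebius (p + h) : ℝ)

/-- The weight-removal identity `M_h(X) = T_h(X)/log X + R_h(X)` (no Abel summation). -/
theorem moebiusShiftedPrimeSum_eq (h X : ℕ) :
    moebiusShiftedPrimeSum h X = 1 / Real.log X * logWeighted h X + remainderR h X := by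
  rw [moebiusShiftedPrimeSum, logWeighted, remainderR, Finset.mul_sum, ← Finset.sum_add_distrib]
  exact Finset.sum_congr rfl fun p _ => by ring

/-- `|R_h(X)| ≤ π(X) - θ(X)/log X` for `X ≥ 2`. -/
theorem abs_remainderR_le (h X : ℕ) (hX : 2 ≤ X) :
    |remainderR h X| ≤ (Nat.primeCounting X : ℝ) - Chebyshev.theta X / Real.log X := by
  have hℓ : 0 < Real.log X := Real.log_pos (by exact_mod_cast (by omega : 1 < X))
  have h1 : |remainderR h X| ≤ ∑ p ∈ Nat.primesLE X, (1 - Real.log p / Real.log X) := by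
    refine (Finset.abs_sum_le_sum_abs _ _).trans (Finset.sum_le_sum fun p hp => ?_)
    have hp := Nat.mem_primesLE.1 hp
    have hlogp : Real.log p ≤ Real.log X :=
      Real.log_le_log (by exact_mod_cast hp.2.pos) (by exact_mod_cast hp.1)
    have h01 : 0 ≤ 1 - Real.log p / Real.log X := by
      rw [sub_nonneg, div_le_one hℓ]
      exact hlogp
    rw [abs_mul, abs_of_nonneg h01]
    have hμ : |(ArithmeticFunction.moebius (p + h) : ℝ)| ≤ 1 := by
      exact_mod_cast ArithmeticFunction.abs_moebius_le_one
    calc (1 - Real.log p / Real.log X) * |(ArithmeticFunction.moebius (p + h) : ℝ)|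
        ≤ (1 - Real.log p / Real.log X) * 1 := mul_le_mul_of_nonneg_left hμ h01
      _ = 1 - Real.log p / Real.log X := mul_one _
  have h2 : ∑ p ∈ Nat.primesLE X, (1 - Real.log p / Real.log X) =
      (Nat.primeCounting X : ℝ) - Chebyshev.theta X / Real.log X := by
    rw [Finset.sum_sub_distrib, Finset.sum_const, nsmul_eq_mul, mul_one, ← Finset.sum_div,
      Nat.primesLE_card_eq_primeCounting, Chebyshev.theta_eq_sum_primesLE_log]
  exact h1.trans h2.le

/-- `|T_h(X)| ≤ |∑_{n ≤ X} Λ(n) μ(n+h)| + (ψ(X) - θ(X))` (prime powers). -/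
theorem abs_logWeighted_le (h X : ℕ) :
    |logWeighted h X| ≤
      |∑ n ∈ Finset.Icc 1 X, Λ n * (ArithmeticFunction.moebius (n + h) : ℝ)| +
        (Chebyshev.psi X - Chebyshev.theta X) := by
  have hsplit := Finset.sum_filter_add_sum_filter_not (Finset.Icc 1 X) Nat.Prime
    (fun n => Λ n * (ArithmeticFunction.moebius (n + h) : ℝ))
  have hT : ∑ n ∈ (Finset.Icc 1 X).filter Nat.Prime, Λ n * (ArithmeticFunction.moebius (n + h) : ℝ) =
      logWeighted h X := by
    rw [logWeighted, Nat.primesLE_eq_filter_Icc_one]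
    refine Finset.sum_congr rfl fun p hp => ?_
    rw [ArithmeticFunction.vonMangoldt_apply_prime (Finset.mem_filter.1 hp).2]
  have hE : |∑ n ∈ (Finset.Icc 1 X).filter (fun n => ¬ n.Prime),
      Λ n * (ArithmeticFunction.moebius (n + h) : ℝ)| ≤ Chebyshev.psi X - Chebyshev.theta X := by
    rw [Chebyshev.psi_sub_theta_eq_sum_not_prime, Nat.floor_natCast]
    have hI : Finset.Ioc 0 X = Finset.Icc 1 X := by
      ext n
      simp only [Finset.mem_Ioc, Finset.mem_Icc]
      omega
    rw [hI]
    refine (Finset.abs_sum_le_sum_abs _ _).trans (Finset.sum_le_sum fun n _ => ?_)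
    rw [abs_mul, abs_of_nonneg ArithmeticFunction.vonMangoldt_nonneg]
    have hμ : |(ArithmeticFunction.moebius (n + h) : ℝ)| ≤ 1 := by
      exact_mod_cast ArithmeticFunction.abs_moebius_le_one
    calc Λ n * |(ArithmeticFunction.moebius (n + h) : ℝ)| ≤ Λ n * 1 :=
        mul_le_mul_of_nonneg_left hμ ArithmeticFunction.vonMangoldt_nonneg
      _ = Λ n := mul_one _
  rw [← hT, eq_sub_of_add_eq hsplit]
  exact (abs_sub _ _).trans (by linarith)

/-- The numerical heart of Placement 2 at a fixed `X`. -/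
theorem pointwise_bound (h X : ℕ) {K c : ℝ} (hK : 0 < K) (hc : 0 < c) (hX : 2 ≤ X)
    (hT : |∑ n ∈ Finset.Icc 1 X, Λ n * (ArithmeticFunction.moebius (n + h) : ℝ)| ≤
      (X : ℝ) / Real.log X ^ 2)
    (hKX : |(Nat.primeCounting X : ℝ) - Chebyshev.theta X / Real.log X| ≤
      K * ((X : ℝ) / Real.log X ^ 2))
    (hπ : (X : ℝ) / (2 * Real.log X) ≤ Nat.primeCounting X)
    (hℓa : 1 ≤ Real.log X) (hℓ1 : 6 / c ≤ Real.log X) (hℓ2 : 6 * K / c ≤ Real.log X)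
    (hℓ3 : Real.log X ≤ c / 12 * Real.sqrt X) :
    |moebiusShiftedPrimeSum h X| ≤ c * Nat.primeCounting X := by
  have hℓ : 0 < Real.log X := by linarith
  have hℓ0 : Real.log X ≠ 0 := hℓ.ne'
  have hX1 : (1 : ℝ) ≤ X := by exact_mod_cast (by omega : 1 ≤ X)
  -- the three small terms
  have hinv1 : 1 / Real.log X ≤ c / 6 := by
    rw [div_le_div_iff₀ hℓ (by norm_num : (0 : ℝ) < 6)]
    have := (div_le_iff₀' hc).1 hℓ1
    linarith
  have hinvK : K / Real.log X ≤ c / 6 := by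
    rw [div_le_div_iff₀ hℓ (by norm_num : (0 : ℝ) < 6)]
    have := (div_le_iff₀' hc).1 hℓ2
    linarith
  have hinv2 : 1 / Real.log X ≤ 1 := by
    rw [div_le_one hℓ]
    exact hℓa
  have hA : (X : ℝ) / Real.log X ^ 3 ≤ (X : ℝ) / Real.log X * (c / 6) := by
    have e : (X : ℝ) / Real.log X ^ 3 = (X : ℝ) / Real.log X * (1 / Real.log X) * (1 / Real.log X) := by
      field_simp
    rw [e]
    calc (X : ℝ) / Real.log X * (1 / Real.log X) * (1 / Real.log X)
        ≤ (X : ℝ) / Real.log X * (c / 6) * 1 := by gcongr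
      _ = (X : ℝ) / Real.log X * (c / 6) := mul_one _
  have hB : 2 * Real.sqrt X ≤ (X : ℝ) / Real.log X * (c / 6) := by
    rw [div_mul_eq_mul_div, le_div_iff₀ hℓ]
    calc 2 * Real.sqrt X * Real.log X ≤ 2 * Real.sqrt X * (c / 12 * Real.sqrt X) := by gcongr
      _ = c / 6 * (Real.sqrt (X : ℝ) * Real.sqrt (X : ℝ)) := by ring
      _ = (X : ℝ) * (c / 6) := by rw [Real.mul_self_sqrt (Nat.cast_nonneg _)]; ring
  have hCt : K * ((X : ℝ) / Real.log X ^ 2) ≤ (X : ℝ) / Real.log X * (c / 6) := by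
    have e : K * ((X : ℝ) / Real.log X ^ 2) = (X : ℝ) / Real.log X * (K / Real.log X) := by
      field_simp
    rw [e]
    gcongr
  -- prime powers and the weight removal
  have hpp : Chebyshev.psi X - Chebyshev.theta X ≤ 2 * Real.sqrt X * Real.log X :=
    Chebyshev.psi_sub_theta_le hX1
  have hTT : |logWeighted h X| ≤ (X : ℝ) / Real.log X ^ 2 + 2 * Real.sqrt X * Real.log X :=
    (abs_logWeighted_le h X).trans (by linarith)
  have hR : |remainderR h X| ≤ K * ((X : ℝ) / Real.log X ^ 2) :=
    (abs_remainderR_le h X hX).trans ((le_abs_self _).trans hKX)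
  have hM : |moebiusShiftedPrimeSum h X| ≤ 1 / Real.log X * |logWeighted h X| + |remainderR h X| := by
    rw [moebiusShiftedPrimeSum_eq]
    calc |1 / Real.log X * logWeighted h X + remainderR h X|
        ≤ |1 / Real.log X * logWeighted h X| + |remainderR h X| := abs_add_le _ _
      _ = 1 / Real.log X * |logWeighted h X| + |remainderR h X| := by
          rw [abs_mul, abs_of_pos (by positivity)]
  have h1 : 1 / Real.log X * |logWeighted h X| ≤ (X : ℝ) / Real.log X ^ 3 + 2 * Real.sqrt X := by
    calc 1 / Real.log X * |logWeighted h X|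
        ≤ 1 / Real.log X * ((X : ℝ) / Real.log X ^ 2 + 2 * Real.sqrt X * Real.log X) := by gcongr
      _ = (X : ℝ) / Real.log X ^ 3 + 2 * Real.sqrt X := by field_simp
  have h3 : c * ((X : ℝ) / (2 * Real.log X)) ≤ c * (Nat.primeCounting X : ℝ) := by gcongr
  have e : c * ((X : ℝ) / (2 * Real.log X)) = 3 * ((X : ℝ) / Real.log X * (c / 6)) := by
    field_simp
    ring
  linarith

/-- From a `log²`-saving for `∑_{n ≤ X} Λ(n) μ(n+h)` at every fixed `h ≥ 1` to the Möbius–shifted-primes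
conjecture `∑_{p ≤ X} μ(p+h) = o(π(X))`. -/
theorem moebiusShiftedPrimesConjecture_of_logSqSaving
    (H : ∀ h : ℕ, 1 ≤ h → ∃ X₀ : ℕ, ∀ X : ℕ, X₀ ≤ X →
      |∑ n ∈ Finset.Icc 1 X, Λ n * (ArithmeticFunction.moebius (n + h) : ℝ)| ≤
        (X : ℝ) / Real.log X ^ 2) :
    MoebiusShiftedPrimesConjecture := by
  intro h hh
  obtain ⟨X₀, hX₀⟩ := H h hh
  refine Asymptotics.isLittleO_iff.2 fun c hc => ?_
  obtain ⟨K, hK0, hK⟩ := Chebyshev.primeCounting_sub_theta_div_log_isBigO.exists_pos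
  have hKev : ∀ᶠ X : ℕ in atTop, |(Nat.primeCounting X : ℝ) - Chebyshev.theta X / Real.log X| ≤
      K * ((X : ℝ) / Real.log X ^ 2) := by
    filter_upwards [tendsto_natCast_atTop_atTop.eventually hK.bound] with X hX
    rw [Real.norm_eq_abs, Real.norm_eq_abs, Nat.floor_natCast,
      abs_of_nonneg (by positivity : (0 : ℝ) ≤ (X : ℝ) / Real.log X ^ 2)] at hX
    exact hX
  have hsqrt : ∀ᶠ X : ℕ in atTop, Real.log X ≤ c / 12 * Real.sqrt X := by
    have h1 := (isLittleO_log_rpow_atTop (by norm_num : (0 : ℝ) < 1 / 2)).bound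
      (show 0 < c / 12 by positivity)
    filter_upwards [tendsto_natCast_atTop_atTop.eventually h1] with X hX
    rw [Real.norm_eq_abs, Real.norm_eq_abs, abs_of_nonneg (Real.log_natCast_nonneg X),
      abs_of_nonneg (by positivity), ← Real.sqrt_eq_rpow] at hX
    exact hX
  have hlog : Tendsto (fun X : ℕ => Real.log X) atTop atTop :=
    Real.tendsto_log_atTop.comp tendsto_natCast_atTop_atTop
  filter_upwards [hKev, hsqrt, Lichtman2020.eventually_primeCounting_ge,
    hlog.eventually_ge_atTop (6 * K / c + 6 / c + 1), Filter.eventually_ge_atTop (max X₀ 2)]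
    with X hKX hsX hπX hℓX hX
  have hX0' : X₀ ≤ X := le_of_max_le_left hX
  have hX2 : 2 ≤ X := le_of_max_le_right hX
  have hKc : 0 ≤ 6 * K / c := by positivity
  have h6c : 0 ≤ 6 / c := by positivity
  rw [Real.norm_eq_abs, Real.norm_eq_abs,
    abs_of_nonneg (show (0 : ℝ) ≤ (Nat.primeCounting X : ℝ) from Nat.cast_nonneg _)]
  exact pointwise_bound h X hK0 hc hX2 (hX₀ X hX0') hKX hπX (by linarith) (by linarith)
    (by linarith) hsX

/-- **Placement 2.** The crux `MobiusCofactorAtom` implies the OPEN Möbius–shifted-primes conjecture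
`Literature.NumberTheory.Sieve.MoebiusShiftedPrimesConjecture` (`∑_{p ≤ X} μ(p + h) = o(π(X))` for
every fixed `h ≥ 1`; Lichtman 2020 p.1, Murty–Vatwani 2017, Sarnak's list Problem 5.2). -/
theorem moebiusShiftedPrimesConjecture_of_atom (hAt : MobiusCofactorAtom) :
    MoebiusShiftedPrimesConjecture := by
  refine moebiusShiftedPrimesConjecture_of_logSqSaving fun h hh => ?_
  obtain ⟨X₀, hX₀⟩ := vonMangoldt_moebius_logSaving_of_atom hAt h hh (by norm_num : (0 : ℝ) < 2)
  refine ⟨X₀, fun X hX => ?_⟩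
  have := hX₀ X hX
  rwa [Real.rpow_two] at this

end Summit.Parity.GeneralizedHardyLittlewood.Cruxes.MobiusCofactorAtom.PlacementR1
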